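import Literature.NumberTheory.IwasawaTheory.ZpExtensionNormKernelOnePrime
import Literature.NumberTheory.NumberFields.OneRamifiedPrimeTower
import Literature.NumberTheory.EllipticCurves.ZpExtensionLayerCharacter
import Literature.NumberTheory.GaloisRepresentations.BrauerCyclicLayer
import HarnessLib

/-!
# Iwasawa's kernel theorem between ANY two layers `K_k ⊆ K_j` of a `ℤ_p`-extension with Fukuda index `0` over a field with one prime above `p`:
# `ker(N : Cl(K_j) → Cl(K_k)) = I_{Gal(K_j/K_k)} · Cl(K_j)` (Washington Prop. 13.22 `A_k ≅ X/ω_k X`, read at the finite level `j`)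

Topic `NumberTheory/IwasawaTheory` (namespace = path).  THEOREM-ONLY file (no definition, no named fact, no `sorry`), written by the prover seat
`bsd-wall-rtt-p4-w2` g20 (cell `bsd-wall`; `--supports` stmt-BirchSwinnertonDyer-21438, line `nonsquare-descent` stub S2; closes nothing; BSD is proved for no
curve here).  Sequel of `ZpExtensionNormKernelOnePrime.lean` (the base pair `K ⊆ K_n`) and `OneRamifiedPrimeTower.lean` (descent of the hypotheses along
`K ⊆ K_k ⊆ K_j`).  The relative layer `K_j / K_k` is given the `K_k`-algebra structure of the inclusion of intermediate fields
`IntermediateField.inclusion (κ.layer_mono hkj)` (declared inside the statements with `letI`, so consumers obtain literally the same instance).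

* **`ker_classGroupNorm_layer_layer_eq_closure_of_totallyRamifiedFrom_zero`** — `κ` a `ℤ_p`-extension of the number field `K` with `TotallyRamifiedFrom κ 0`,
  `K` with exactly one prime above `p`, `k ≤ j`: `ker (N : Cl(K_j) → Cl(K_k)) = ⟨τ c / c : τ ∈ Gal(K_j/K_k)⟩`.
* `isCyclic_aut_layer_layer` — `Gal(K_j/K_k)` is cyclic (it embeds in the cyclic `Gal(K_j/K)`, tree `isCyclic_of_cyclicLayer`);
  **`exists_generator_forall_primary_eq_div_of_totallyRamifiedFrom_zero`** — the CYCLIC `p`-PRIMARY form: a generator `σ` of `Gal(K_j/K_k)` with: every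
  `p`-primary class `c` of `K_j` with `N_{K_j/K_k} c = 1` is `σ d / d` for a `p`-primary `d` («`ker(A_j → A_k) = ω_k A_j` on `A = Cl[p^∞]`»).
* § Generic algebra and the NAMED generator (for consumers with their own compatible `Algebra (κ.layer k) (κ.layer j)`, `IsScalarTower K (κ.layer k) (κ.layer j)`,
  and a topological generator `γ`, `κ.IsTopGenerator γ`): `ker_classGroupNorm_layer_layer_eq_closure` (generic kernel theorem), `isCyclic_aut_layer_layer'`,
  `classGroupNorm_layer_layer_eq_one_iff_of_zpowers_eq_top` and `forall_primary_eq_div_of_zpowers_eq_top` (the cyclic forms for a GIVEN generator `σ`),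
  `zpowers_absRestrictNormalHom_layer_eq_top` / `orderOf_absRestrictNormalHom_layer` (`γ|_{K_j}` generates `Gal(K_j/K)`, of order `p^j`),
  **`exists_aut_layer_layer_eq_topGenerator_pow`** (`γ^{p^k}|_{K_j}` is a generator of `Gal(K_j/K_k)`, characterised pointwise in `K̄`) and the headline
  **`exists_topGenerator_pow_aut_forall_classGroupNorm_eq_one_iff`**: `N_{K_j/K_k} c = 1 ⟺ c = γ^{p^k} d / d` (and the `p`-primary form) — «`ker(A_j → A_k) = ω_k A_j`,
  `ω_k = γ^{p^k} − 1`» literally.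
* § Degrees (generic algebra, `k ≤ j`): `finrank_layer_layer` (`[K_j : K_k] = p^{j−k}`), `isGalois_layer_layer`, `card_aut_layer_layer` (`#Gal(K_j/K_k) = p^{j−k}`),
  `orderOf_eq_of_zpowers_eq_top_layer_layer` (a generator has order `p^{j−k}`).

References: [Washington1997] §13.3 Lemma 13.15, Prop. 13.22; [Lang1990] Ch. 5 §4 Thm. 4.1 and Corollary (`C_n ≈ C/C^{γ^{pⁿ}−1}`); [Fukuda1994] p. 264.
-/

noncomputable section

open scoped NumberField
open NumberField IsDedekindDomain Field Ideal

namespace Literature.NumberTheory.IwasawaTheory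

open Literature.NumberTheory.EllipticCurves Literature.NumberTheory.NumberFields
  Literature.NumberTheory.NumberFields.ClassGroupNormKernel
  Literature.NumberTheory.GaloisRepresentations

variable {K : Type} [Field K] [NumberField K] {p : ℕ} [hp : Fact p.Prime] (κ : ZpExtension K p)

/-- **`ker N_{K_j/K_k} = I_{Gal(K_j/K_k)} · Cl(K_j)` for all layers `k ≤ j`** of a `ℤ_p`-extension `κ` of `K` with Fukuda index `0`
(`TotallyRamifiedFrom κ 0`) over a number field `K` with exactly one prime `v₀` above `p` (the inclusion `K_k ⊆ K_j` as `K_k`-algebra structure).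
The totally ramified prime of `K_j` and the uniqueness hypotheses come from `exists_ramificationIdx_eq_pow_of_totallyRamifiedFrom_zero` at level `j`
and descend to `K_j/K_k` by `ClassGroupNormKernel.ker_classGroupNorm_eq_closure_top`. [cite: Washington1997, §13.3 Lemma 13.15 and Prop. 13.22]
[cite: Lang1990, Ch. 5 §4 Thm. 4.1 and Corollary] -/
theorem ker_classGroupNorm_layer_layer_eq_closure_of_totallyRamifiedFrom_zero (hκ : TotallyRamifiedFrom κ 0)
    (v₀ : HeightOneSpectrum (𝓞 K)) (hv₀ : ∀ w : HeightOneSpectrum (𝓞 K), ((p : ℕ) : 𝓞 K) ∈ w.asIdeal → w = v₀)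
    {k j : ℕ} (hkj : k ≤ j) [NumberField (κ.layer k)] [NumberField (κ.layer j)] :
    letI : Algebra (κ.layer k) (κ.layer j) := (IntermediateField.inclusion (κ.layer_mono hkj)).toRingHom.toAlgebra
    (classGroupNorm (κ.layer k) (κ.layer j)).ker = Subgroup.closure {x : ClassGroup (𝓞 (κ.layer j)) |
      ∃ (τ : (κ.layer j) ≃ₐ[κ.layer k] (κ.layer j)) (d : ClassGroup (𝓞 (κ.layer j))),
        x = ClassGroup.mulEquiv (AmbiguousClass.intAut τ) d / d} := by
  letI : Algebra (κ.layer k) (κ.layer j) := (IntermediateField.inclusion (κ.layer_mono hkj)).toRingHom.toAlgebra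
  haveI : IsScalarTower K (κ.layer k) (κ.layer j) :=
    IsScalarTower.of_algebraMap_eq fun x => ((IntermediateField.inclusion (κ.layer_mono hkj)).commutes x).symm
  haveI : FiniteDimensional K (κ.layer k) := κ.finiteDimensional_layer_holds k
  haveI : FiniteDimensional K (κ.layer j) := κ.finiteDimensional_layer_holds j
  haveI : IsGalois K (κ.layer k) := κ.isGalois_layer_holds k
  haveI : IsGalois K (κ.layer j) := κ.isGalois_layer_holds j
  haveI : IsUnramifiedAtInfinitePlaces K (κ.layer j) := κ.isUnramifiedAtInfinitePlaces_layer j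
  obtain ⟨𝔓', h𝔓'max, h𝔓', huniq'⟩ := exists_ramificationIdx_eq_pow_of_totallyRamifiedFrom_zero κ j hκ v₀ hv₀
  haveI := h𝔓'max
  exact ker_classGroupNorm_eq_closure_top (B := K) (F := κ.layer k) (F' := κ.layer j) 𝔓' (by rw [h𝔓', κ.finrank_layer_holds j])
    (fun Q' _ hQ' => eq_of_ramificationIdx_layer_ne_one κ j 𝔓' huniq' Q' hQ')

/-- **`Gal(K_j/K_k)` is cyclic** (it restricts injectively into `Gal(K_j/K) ≅ ℤ/p^j`, cyclic by the layer character, tree `exists_cyclicCharacter_layer`,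
`isCyclic_of_cyclicLayer`). [cite: Washington1997, §13.1 (`Gal(K_n/K) ≅ ℤ/pⁿ`)] -/
theorem isCyclic_aut_layer_layer {k j : ℕ} (hkj : k ≤ j) :
    letI : Algebra (κ.layer k) (κ.layer j) := (IntermediateField.inclusion (κ.layer_mono hkj)).toRingHom.toAlgebra
    IsCyclic ((κ.layer j) ≃ₐ[κ.layer k] (κ.layer j)) := by
  letI : Algebra (κ.layer k) (κ.layer j) := (IntermediateField.inclusion (κ.layer_mono hkj)).toRingHom.toAlgebra
  haveI : IsScalarTower K (κ.layer k) (κ.layer j) :=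
    IsScalarTower.of_algebraMap_eq fun x => ((IntermediateField.inclusion (κ.layer_mono hkj)).commutes x).symm
  haveI : IsGalois K (κ.layer j) := κ.isGalois_layer_holds j
  haveI : NeZero (p ^ j) := ⟨pow_ne_zero j hp.out.ne_zero⟩
  obtain ⟨ψ, -, hker, -⟩ := κ.exists_cyclicCharacter_layer j
  haveI : IsCyclic ((κ.layer j) ≃ₐ[K] (κ.layer j)) := isCyclic_of_cyclicLayer ψ (κ.layer j) hker
  let ι : ((κ.layer j) ≃ₐ[κ.layer k] (κ.layer j)) →* ((κ.layer j) ≃ₐ[K] (κ.layer j)) :=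
    { toFun := fun σ => σ.restrictScalars K
      map_one' := rfl
      map_mul' := fun _ _ => rfl }
  have hι : Function.Injective ι := fun σ τ h => AlgEquiv.restrictScalars_injective K h
  exact isCyclic_of_surjective (MonoidHom.ofInjective hι).symm.toMonoidHom (MonoidHom.ofInjective hι).symm.surjective

/-- **The cyclic `p`-primary form between two layers** (`κ` with Fukuda index `0` over `K` with one prime above `p`, `k ≤ j`): there is a generator `σ` of
`Gal(K_j/K_k)` such that every `p`-PRIMARY class `c` of `K_j` (`c ^ p ^ m = 1`) with `N_{K_j/K_k} c = 1` is `σ d / d` for a `p`-primary class `d`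
(`d ^ p ^ a = 1`, `p ^ a ∥ h(K_j)`) — literally «`ker(A_j → A_k) = ω_k A_j`» for `A = Cl[p^∞]`, `ω_k = γ^{p^k} − 1` acting as `σ − 1`.
[cite: Washington1997, §13.3 Lemma 13.15 and Prop. 13.22] [cite: Lang1990, Ch. 5 §4 Thm. 4.1 and Corollary] -/
theorem exists_generator_forall_primary_eq_div_of_totallyRamifiedFrom_zero (hκ : TotallyRamifiedFrom κ 0)
    (v₀ : HeightOneSpectrum (𝓞 K)) (hv₀ : ∀ w : HeightOneSpectrum (𝓞 K), ((p : ℕ) : 𝓞 K) ∈ w.asIdeal → w = v₀)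
    {k j : ℕ} (hkj : k ≤ j) [NumberField (κ.layer k)] [NumberField (κ.layer j)] :
    letI : Algebra (κ.layer k) (κ.layer j) := (IntermediateField.inclusion (κ.layer_mono hkj)).toRingHom.toAlgebra
    ∃ σ : (κ.layer j) ≃ₐ[κ.layer k] (κ.layer j), Subgroup.zpowers σ = ⊤ ∧
      ∀ {m : ℕ} {c : ClassGroup (𝓞 (κ.layer j))}, c ^ p ^ m = 1 → classGroupNorm (κ.layer k) (κ.layer j) c = 1 →
        ∃ d : ClassGroup (𝓞 (κ.layer j)), d ^ p ^ (Fintype.card (ClassGroup (𝓞 (κ.layer j)))).factorization p = 1 ∧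
          c = ClassGroup.mulEquiv (AmbiguousClass.intAut σ) d / d := by
  letI : Algebra (κ.layer k) (κ.layer j) := (IntermediateField.inclusion (κ.layer_mono hkj)).toRingHom.toAlgebra
  haveI : IsScalarTower K (κ.layer k) (κ.layer j) :=
    IsScalarTower.of_algebraMap_eq fun x => ((IntermediateField.inclusion (κ.layer_mono hkj)).commutes x).symm
  haveI : FiniteDimensional K (κ.layer k) := κ.finiteDimensional_layer_holds k
  haveI : FiniteDimensional K (κ.layer j) := κ.finiteDimensional_layer_holds j
  haveI : IsGalois K (κ.layer k) := κ.isGalois_layer_holds k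
  haveI : IsGalois K (κ.layer j) := κ.isGalois_layer_holds j
  haveI : IsGalois (κ.layer k) (κ.layer j) := IsGalois.tower_top_of_isGalois K (κ.layer k) (κ.layer j)
  haveI : IsUnramifiedAtInfinitePlaces K (κ.layer j) := κ.isUnramifiedAtInfinitePlaces_layer j
  haveI : IsUnramifiedAtInfinitePlaces (κ.layer k) (κ.layer j) := IsUnramifiedAtInfinitePlaces.top K (κ.layer k) (κ.layer j)
  obtain ⟨σ, hσ⟩ := (isCyclic_aut_layer_layer κ hkj).exists_generator
  have hσ' : Subgroup.zpowers σ = ⊤ := (Subgroup.eq_top_iff' _).mpr hσ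
  obtain ⟨𝔓', h𝔓'max, h𝔓', huniq'⟩ := exists_ramificationIdx_eq_pow_of_totallyRamifiedFrom_zero κ j hκ v₀ hv₀
  haveI := h𝔓'max
  have hfin : 𝔓'.ramificationIdx (𝓞 K) = Module.finrank K (κ.layer j) := by rw [h𝔓', κ.finrank_layer_holds j]
  have huniq'' : ∀ (Q' : Ideal (𝓞 (κ.layer j))) [Q'.IsMaximal], Q'.ramificationIdx (𝓞 K) ≠ 1 → Q' = 𝔓' :=
    fun Q' _ hQ' => eq_of_ramificationIdx_layer_ne_one κ j 𝔓' huniq' Q' hQ'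
  refine ⟨σ, hσ', fun {m c} hc hN => ?_⟩
  exact exists_primary_eq_div_of_classGroupNorm_eq_one σ hσ' 𝔓'
    (ramificationIdx_eq_finrank_top (B := K) (F := κ.layer k) (F' := κ.layer j) 𝔓' hfin)
    (fun Q' _ hQ' => eq_top_of_ramificationIdx_ne_one_top (B := K) (F := κ.layer k) 𝔓' huniq'' Q' hQ') hp.out hc hN

/-! ## § Generic algebra structure and the named generator `γ^{p^k}|_{K_j}`

The statements below take ANY `Algebra (κ.layer k) (κ.layer j)` compatible with `K` (`IsScalarTower K (κ.layer k) (κ.layer j)`; e.g. the inclusion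
instance of the first section, or the instances of the tree's Dokchitser / `ClassicalMuVanishesUnitNormIndexGenerated` files) and name the generator. -/

section Generic

variable {k j : ℕ} [Algebra (κ.layer k) (κ.layer j)] [IsScalarTower K (κ.layer k) (κ.layer j)]

/-- **`ker N_{K_j/K_k} = I_{Gal(K_j/K_k)} · Cl(K_j)`** (generic compatible algebra structure `K_k → K_j`), for `κ` with Fukuda index `0` over `K` with one
prime above `p`. [cite: Washington1997, §13.3 Lemma 13.15 and Prop. 13.22] [cite: Lang1990, Ch. 5 §4 Thm. 4.1 and Corollary] -/
theorem ker_classGroupNorm_layer_layer_eq_closure (hκ : TotallyRamifiedFrom κ 0)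
    (v₀ : HeightOneSpectrum (𝓞 K)) (hv₀ : ∀ w : HeightOneSpectrum (𝓞 K), ((p : ℕ) : 𝓞 K) ∈ w.asIdeal → w = v₀)
    [NumberField (κ.layer k)] [NumberField (κ.layer j)] :
    (classGroupNorm (κ.layer k) (κ.layer j)).ker = Subgroup.closure {x : ClassGroup (𝓞 (κ.layer j)) |
      ∃ (τ : (κ.layer j) ≃ₐ[κ.layer k] (κ.layer j)) (d : ClassGroup (𝓞 (κ.layer j))),
        x = ClassGroup.mulEquiv (AmbiguousClass.intAut τ) d / d} := by
  haveI : FiniteDimensional K (κ.layer k) := κ.finiteDimensional_layer_holds k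
  haveI : FiniteDimensional K (κ.layer j) := κ.finiteDimensional_layer_holds j
  haveI : IsGalois K (κ.layer k) := κ.isGalois_layer_holds k
  haveI : IsGalois K (κ.layer j) := κ.isGalois_layer_holds j
  haveI : IsUnramifiedAtInfinitePlaces K (κ.layer j) := κ.isUnramifiedAtInfinitePlaces_layer j
  obtain ⟨𝔓', h𝔓'max, h𝔓', huniq'⟩ := exists_ramificationIdx_eq_pow_of_totallyRamifiedFrom_zero κ j hκ v₀ hv₀
  haveI := h𝔓'max
  exact ker_classGroupNorm_eq_closure_top (B := K) (F := κ.layer k) (F' := κ.layer j) 𝔓' (by rw [h𝔓', κ.finrank_layer_holds j])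
    (fun Q' _ hQ' => eq_of_ramificationIdx_layer_ne_one κ j 𝔓' huniq' Q' hQ')

/-- **`Gal(K_j/K_k)` is cyclic** (generic compatible algebra structure). [cite: Washington1997, §13.1 (`Gal(K_n/K) ≅ ℤ/pⁿ`)] -/
theorem isCyclic_aut_layer_layer' : IsCyclic ((κ.layer j) ≃ₐ[κ.layer k] (κ.layer j)) := by
  haveI : IsGalois K (κ.layer j) := κ.isGalois_layer_holds j
  haveI : NeZero (p ^ j) := ⟨pow_ne_zero j hp.out.ne_zero⟩
  obtain ⟨ψ, -, hker, -⟩ := κ.exists_cyclicCharacter_layer j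
  haveI : IsCyclic ((κ.layer j) ≃ₐ[K] (κ.layer j)) := isCyclic_of_cyclicLayer ψ (κ.layer j) hker
  let ι : ((κ.layer j) ≃ₐ[κ.layer k] (κ.layer j)) →* ((κ.layer j) ≃ₐ[K] (κ.layer j)) :=
    { toFun := fun σ => σ.restrictScalars K
      map_one' := rfl
      map_mul' := fun _ _ => rfl }
  have hι : Function.Injective ι := fun σ τ h => AlgEquiv.restrictScalars_injective K h
  exact isCyclic_of_surjective (MonoidHom.ofInjective hι).symm.toMonoidHom (MonoidHom.ofInjective hι).symm.surjective

/-- **`N_{K_j/K_k} c = 1 ⟺ c = σ d / d` for a GIVEN generator `σ` of `Gal(K_j/K_k)`** (generic compatible algebra structure; `κ` with Fukuda index `0`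
over `K` with one prime above `p`). [cite: Washington1997, §13.3 Lemma 13.15 and Prop. 13.22] [cite: Lang1990, Ch. 5 §4 Thm. 4.1 and Corollary] -/
theorem classGroupNorm_layer_layer_eq_one_iff_of_zpowers_eq_top (hκ : TotallyRamifiedFrom κ 0)
    (v₀ : HeightOneSpectrum (𝓞 K)) (hv₀ : ∀ w : HeightOneSpectrum (𝓞 K), ((p : ℕ) : 𝓞 K) ∈ w.asIdeal → w = v₀)
    [NumberField (κ.layer k)] [NumberField (κ.layer j)]
    (σ : (κ.layer j) ≃ₐ[κ.layer k] (κ.layer j)) (hσ : Subgroup.zpowers σ = ⊤) (c : ClassGroup (𝓞 (κ.layer j))) :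
    classGroupNorm (κ.layer k) (κ.layer j) c = 1 ↔
      ∃ d : ClassGroup (𝓞 (κ.layer j)), c = ClassGroup.mulEquiv (AmbiguousClass.intAut σ) d / d := by
  haveI : FiniteDimensional K (κ.layer k) := κ.finiteDimensional_layer_holds k
  haveI : FiniteDimensional K (κ.layer j) := κ.finiteDimensional_layer_holds j
  haveI : IsGalois K (κ.layer k) := κ.isGalois_layer_holds k
  haveI : IsGalois K (κ.layer j) := κ.isGalois_layer_holds j
  haveI : IsGalois (κ.layer k) (κ.layer j) := IsGalois.tower_top_of_isGalois K (κ.layer k) (κ.layer j)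
  haveI : IsUnramifiedAtInfinitePlaces K (κ.layer j) := κ.isUnramifiedAtInfinitePlaces_layer j
  haveI : IsUnramifiedAtInfinitePlaces (κ.layer k) (κ.layer j) := IsUnramifiedAtInfinitePlaces.top K (κ.layer k) (κ.layer j)
  obtain ⟨𝔓', h𝔓'max, h𝔓', huniq'⟩ := exists_ramificationIdx_eq_pow_of_totallyRamifiedFrom_zero κ j hκ v₀ hv₀
  haveI := h𝔓'max
  have hfin : 𝔓'.ramificationIdx (𝓞 K) = Module.finrank K (κ.layer j) := by rw [h𝔓', κ.finrank_layer_holds j]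
  have huniq'' : ∀ (Q' : Ideal (𝓞 (κ.layer j))) [Q'.IsMaximal], Q'.ramificationIdx (𝓞 K) ≠ 1 → Q' = 𝔓' :=
    fun Q' _ hQ' => eq_of_ramificationIdx_layer_ne_one κ j 𝔓' huniq' Q' hQ'
  exact classGroupNorm_eq_one_iff_of_zpowers_eq_top σ hσ 𝔓'
    (ramificationIdx_eq_finrank_top (B := K) (F := κ.layer k) (F' := κ.layer j) 𝔓' hfin)
    (fun Q' _ hQ' => eq_top_of_ramificationIdx_ne_one_top (B := K) (F := κ.layer k) 𝔓' huniq'' Q' hQ') c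

/-- **The `p`-primary cyclic form for a GIVEN generator `σ` of `Gal(K_j/K_k)`**: a `p`-primary class `c` of `K_j` with `N_{K_j/K_k} c = 1` is `σ d / d`
with `d` `p`-primary (`d ^ p ^ a = 1`, `p ^ a ∥ h(K_j)`). [cite: Washington1997, §13.3 Lemma 13.15 and Prop. 13.22] [cite: Lang1990, Ch. 5 §4 Thm. 4.1 and Corollary] -/
theorem forall_primary_eq_div_of_zpowers_eq_top (hκ : TotallyRamifiedFrom κ 0)
    (v₀ : HeightOneSpectrum (𝓞 K)) (hv₀ : ∀ w : HeightOneSpectrum (𝓞 K), ((p : ℕ) : 𝓞 K) ∈ w.asIdeal → w = v₀)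
    [NumberField (κ.layer k)] [NumberField (κ.layer j)]
    (σ : (κ.layer j) ≃ₐ[κ.layer k] (κ.layer j)) (hσ : Subgroup.zpowers σ = ⊤)
    {m : ℕ} {c : ClassGroup (𝓞 (κ.layer j))} (hc : c ^ p ^ m = 1) (hN : classGroupNorm (κ.layer k) (κ.layer j) c = 1) :
    ∃ d : ClassGroup (𝓞 (κ.layer j)), d ^ p ^ (Fintype.card (ClassGroup (𝓞 (κ.layer j)))).factorization p = 1 ∧
      c = ClassGroup.mulEquiv (AmbiguousClass.intAut σ) d / d := by
  haveI : FiniteDimensional K (κ.layer k) := κ.finiteDimensional_layer_holds k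
  haveI : FiniteDimensional K (κ.layer j) := κ.finiteDimensional_layer_holds j
  haveI : IsGalois K (κ.layer k) := κ.isGalois_layer_holds k
  haveI : IsGalois K (κ.layer j) := κ.isGalois_layer_holds j
  haveI : IsGalois (κ.layer k) (κ.layer j) := IsGalois.tower_top_of_isGalois K (κ.layer k) (κ.layer j)
  haveI : IsUnramifiedAtInfinitePlaces K (κ.layer j) := κ.isUnramifiedAtInfinitePlaces_layer j
  haveI : IsUnramifiedAtInfinitePlaces (κ.layer k) (κ.layer j) := IsUnramifiedAtInfinitePlaces.top K (κ.layer k) (κ.layer j)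
  obtain ⟨𝔓', h𝔓'max, h𝔓', huniq'⟩ := exists_ramificationIdx_eq_pow_of_totallyRamifiedFrom_zero κ j hκ v₀ hv₀
  haveI := h𝔓'max
  have hfin : 𝔓'.ramificationIdx (𝓞 K) = Module.finrank K (κ.layer j) := by rw [h𝔓', κ.finrank_layer_holds j]
  have huniq'' : ∀ (Q' : Ideal (𝓞 (κ.layer j))) [Q'.IsMaximal], Q'.ramificationIdx (𝓞 K) ≠ 1 → Q' = 𝔓' :=
    fun Q' _ hQ' => eq_of_ramificationIdx_layer_ne_one κ j 𝔓' huniq' Q' hQ'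
  exact exists_primary_eq_div_of_classGroupNorm_eq_one σ hσ 𝔓'
    (ramificationIdx_eq_finrank_top (B := K) (F := κ.layer k) (F' := κ.layer j) 𝔓' hfin)
    (fun Q' _ hQ' => eq_top_of_ramificationIdx_ne_one_top (B := K) (F := κ.layer k) 𝔓' huniq'' Q' hQ') hp.out hc hN

end Generic

/-! ### The named generator: `γ|_{K_j}` generates `Gal(K_j/K)` and `γ^{p^k}|_{K_j}` generates `Gal(K_j/K_k)` -/

section Generator

/-- Restriction `Γ_K → Gal(K_j/K)` is onto (Mathlib `AlgEquiv.restrictNormalHom_surjective`). [folklore] -/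
private theorem absRestrictNormalHom_layer_surjective (j : ℕ) [Normal K (κ.layer j)] :
    Function.Surjective (absRestrictNormalHom (κ.layer j)) := fun g => by
  obtain ⟨σ, hσ⟩ := AlgEquiv.restrictNormalHom_surjective (AlgebraicClosure K) g
  exact ⟨(absoluteGaloisGroup.toAlgEquiv K).symm σ, by
    change AlgEquiv.restrictNormalHom (κ.layer j) ((absoluteGaloisGroup.toAlgEquiv K) ((absoluteGaloisGroup.toAlgEquiv K).symm σ)) = g
    rw [MulEquiv.apply_symm_apply, hσ]⟩

/-- `g|_{K_j} = 1 ⟺ g ∈ κ⁻¹(p^j ℤ_p)` (Krull–Galois for the layer: tree `exists_cyclicCharacter_layer` gives `galFixing K K_j = κ⁻¹(p^j ℤ_p)`). [folklore] -/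
private theorem absRestrictNormalHom_layer_eq_one_iff_mem (j : ℕ) [Normal K (κ.layer j)] (g : absoluteGaloisGroup K) :
    absRestrictNormalHom (κ.layer j) g = 1 ↔ g ∈ κ.layerSubgroup j := by
  obtain ⟨ψ, hker, hker', -⟩ := κ.exists_cyclicCharacter_layer j
  rw [← hker, hker']
  exact restrictNormalHom_eq_one_iff (κ.layer j) g

/-- `g ∈ κ⁻¹(p^j ℤ_p)` fixes `K_j` pointwise (in `K̄`). [folklore] -/
private theorem smul_eq_self_of_mem_layerSubgroup {j : ℕ} {g : absoluteGaloisGroup K} (hg : g ∈ κ.layerSubgroup j)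
    {x : AlgebraicClosure K} (hx : x ∈ κ.layer j) : g • x = x := by
  obtain ⟨ψ, hker, hker', -⟩ := κ.exists_cyclicCharacter_layer j
  rw [← hker, hker', LocalWeilDatum.mem_galFixing_iff] at hg
  exact hg x hx

omit [NumberField K] in
/-- `γ^{p^k · i} ∈ κ⁻¹(p^k ℤ_p)` for a topological generator `γ` (`κ(γ^{p^k i}) = p^k i`). [folklore] -/
private theorem topGenerator_pow_mul_mem_layerSubgroup {γ : absoluteGaloisGroup K} (hγ : κ.IsTopGenerator γ) (k i : ℕ) :
    γ ^ (p ^ k * i) ∈ κ.layerSubgroup k := by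
  rw [ZpExtension.mem_layerSubgroup, map_pow, toAdd_pow, hγ, toAdd_ofAdd, nsmul_eq_mul, mul_one, Nat.cast_mul, Nat.cast_pow]
  exact Dvd.intro _ rfl

omit [NumberField K] in
/-- Every `τ ∈ Γ_K` is `γ^i` times an element of `κ⁻¹(p^j ℤ_p)` (`i = appr_j (κ τ)`). [folklore] -/
private theorem exists_pow_inv_mul_mem_layerSubgroup_of_isTopGenerator {γ : absoluteGaloisGroup K} (hγ : κ.IsTopGenerator γ) (j : ℕ)
    (τ : absoluteGaloisGroup K) : ∃ i : ℕ, (γ ^ i)⁻¹ * τ ∈ κ.layerSubgroup j := by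
  refine ⟨((κ τ).toAdd).appr j, ?_⟩
  rw [ZpExtension.mem_layerSubgroup, map_mul, map_inv, map_pow, toAdd_mul, toAdd_inv, toAdd_pow, hγ, toAdd_ofAdd, nsmul_eq_mul, mul_one,
    ← Ideal.mem_span_singleton, show -(((((κ τ).toAdd).appr j : ℕ) : ℤ_[p])) + (κ τ).toAdd = (κ τ).toAdd - (((κ τ).toAdd).appr j : ℕ) by ring]
  exact PadicInt.appr_spec j (κ τ).toAdd

/-- **`γ|_{K_j}` generates `Gal(K_j/K)`** for a topological generator `γ` of `κ` (`κ γ = 1`): every `τ ∈ Γ_K` is `γ^i` on `K_j`.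
[cite: Washington1997, §13.1 (`Gal(K_n/K) ≅ ℤ/pⁿ` generated by `γ`)] -/
theorem zpowers_absRestrictNormalHom_layer_eq_top {γ : absoluteGaloisGroup K} (hγ : κ.IsTopGenerator γ) (j : ℕ) [Normal K (κ.layer j)] :
    Subgroup.zpowers (absRestrictNormalHom (κ.layer j) γ) = ⊤ := by
  rw [Subgroup.eq_top_iff']
  intro g
  obtain ⟨τ, rfl⟩ := absRestrictNormalHom_layer_surjective κ j g
  obtain ⟨i, hi⟩ := exists_pow_inv_mul_mem_layerSubgroup_of_isTopGenerator κ hγ j τ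
  have h1 : absRestrictNormalHom (κ.layer j) ((γ ^ i)⁻¹ * τ) = 1 := (absRestrictNormalHom_layer_eq_one_iff_mem κ j _).mpr hi
  rw [map_mul, map_inv, inv_mul_eq_one] at h1
  rw [← h1, map_pow]
  exact Subgroup.npow_mem_zpowers _ i

/-- **`γ|_{K_j}` has order `p^j = [K_j : K]`.** [cite: Washington1997, §13.1 (`Gal(K_n/K) ≅ ℤ/pⁿ` generated by `γ`)] -/
theorem orderOf_absRestrictNormalHom_layer {γ : absoluteGaloisGroup K} (hγ : κ.IsTopGenerator γ) (j : ℕ) [Normal K (κ.layer j)] :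
    orderOf (absRestrictNormalHom (κ.layer j) γ) = p ^ j := by
  haveI : FiniteDimensional K (κ.layer j) := κ.finiteDimensional_layer_holds j
  haveI : IsGalois K (κ.layer j) := κ.isGalois_layer_holds j
  rw [orderOf_eq_card_of_zpowers_eq_top (zpowers_absRestrictNormalHom_layer_eq_top κ hγ j), IsGalois.card_aut_eq_finrank,
    κ.finrank_layer_holds j]

variable {k j : ℕ} [Algebra (κ.layer k) (κ.layer j)] [IsScalarTower K (κ.layer k) (κ.layer j)]

omit [NumberField K] in
/-- With a compatible algebra structure `K_k → K_j ⊆ K̄`, the image of `x ∈ K_k` in `K̄` lies in `K_k` (`K_k/K` normal). [folklore] -/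
private theorem algebraMap_layer_mem [Normal K (κ.layer k)] (x : κ.layer k) :
    ((algebraMap (κ.layer k) (κ.layer j) x : κ.layer j) : AlgebraicClosure K) ∈ κ.layer k := by
  let f : (κ.layer k) →ₐ[K] AlgebraicClosure K := (κ.layer j).val.comp (IsScalarTower.toAlgHom K (κ.layer k) (κ.layer j))
  have hx : f x ∈ f.fieldRange := ⟨x, rfl⟩
  rw [AlgHom.fieldRange_of_normal] at hx
  exact hx

/-- **`γ^{p^k}|_{K_j}` is a generator of `Gal(K_j/K_k)`** (`k ≤ j`, any compatible algebra structure `K_k → K_j`, `γ` a topological generator of `κ`):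
there is `σ ∈ Gal(K_j/K_k)` acting on `K_j ⊆ K̄` as `γ^{p^k}`, and it generates. [cite: Washington1997, §13.1 (`Gal(K_m/K_n)` generated by `γ^{pⁿ}`)] -/
theorem exists_aut_layer_layer_eq_topGenerator_pow {γ : absoluteGaloisGroup K} (hγ : κ.IsTopGenerator γ) (hkj : k ≤ j) :
    ∃ σ : (κ.layer j) ≃ₐ[κ.layer k] (κ.layer j),
      (∀ x : κ.layer j, ((σ x : κ.layer j) : AlgebraicClosure K) = (γ ^ p ^ k) • (x : AlgebraicClosure K)) ∧ Subgroup.zpowers σ = ⊤ := by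
  haveI : FiniteDimensional K (κ.layer k) := κ.finiteDimensional_layer_holds k
  haveI : FiniteDimensional K (κ.layer j) := κ.finiteDimensional_layer_holds j
  haveI : IsGalois K (κ.layer k) := κ.isGalois_layer_holds k
  haveI : IsGalois K (κ.layer j) := κ.isGalois_layer_holds j
  haveI : IsGalois (κ.layer k) (κ.layer j) := IsGalois.tower_top_of_isGalois K (κ.layer k) (κ.layer j)
  haveI : FiniteDimensional (κ.layer k) (κ.layer j) := Module.Finite.of_restrictScalars_finite K _ _
  set g : (κ.layer j) ≃ₐ[K] (κ.layer j) := absRestrictNormalHom (κ.layer j) (γ ^ p ^ k) with hg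
  have hgx : ∀ x : κ.layer j, ((g x : κ.layer j) : AlgebraicClosure K) = (γ ^ p ^ k) • (x : AlgebraicClosure K) := fun x => by
    rw [hg, absoluteGaloisGroup.smul_def]
    exact AlgEquiv.restrictNormal_commutes (absoluteGaloisGroup.toAlgEquiv K (γ ^ p ^ k)) (κ.layer j) x
  have hmem : γ ^ p ^ k ∈ κ.layerSubgroup k := by simpa only [mul_one] using topGenerator_pow_mul_mem_layerSubgroup κ hγ k 1
  have hcomm : ∀ x : κ.layer k, g (algebraMap (κ.layer k) (κ.layer j) x) = algebraMap (κ.layer k) (κ.layer j) x := fun x => by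
    apply Subtype.ext
    rw [hgx]
    exact smul_eq_self_of_mem_layerSubgroup κ hmem (algebraMap_layer_mem κ x)
  let σ : (κ.layer j) ≃ₐ[κ.layer k] (κ.layer j) := { g.toRingEquiv with commutes' := hcomm }
  have hσg : σ.restrictScalars K = g := by ext x; rfl
  refine ⟨σ, fun x => hgx x, ?_⟩
  -- `σ` generates: its order is `p^j / p^k = [K_j : K_k] = #Gal(K_j/K_k)`
  let ι : ((κ.layer j) ≃ₐ[κ.layer k] (κ.layer j)) →* ((κ.layer j) ≃ₐ[K] (κ.layer j)) :=
    { toFun := fun τ => τ.restrictScalars K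
      map_one' := rfl
      map_mul' := fun _ _ => rfl }
  have hι : Function.Injective ι := fun τ τ' h => AlgEquiv.restrictScalars_injective K h
  have hp0 : 0 < p := hp.out.pos
  have hord : orderOf σ = p ^ (j - k) := by
    rw [← orderOf_injective ι hι σ, show ι σ = g from hσg, hg, map_pow,
      orderOf_pow_of_dvd (pow_ne_zero k hp.out.ne_zero) (by rw [orderOf_absRestrictNormalHom_layer κ hγ j]; exact pow_dvd_pow p hkj),
      orderOf_absRestrictNormalHom_layer κ hγ j, Nat.pow_div hkj hp0]
  have hdeg : Module.finrank (κ.layer k) (κ.layer j) = p ^ (j - k) := by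
    have h := Module.finrank_mul_finrank K (κ.layer k) (κ.layer j)
    rw [κ.finrank_layer_holds k, κ.finrank_layer_holds j] at h
    rw [← Nat.pow_div hkj hp0]
    exact (Nat.div_eq_of_eq_mul_right (pow_pos hp0 k) h.symm).symm
  apply Subgroup.eq_top_of_card_eq
  rw [Nat.card_zpowers, hord, IsGalois.card_aut_eq_finrank, hdeg]

/-- **HEADLINE — «`ker(A_j → A_k) = ω_k A_j`, `ω_k = γ^{p^k} − 1`» for the layers `K_k ⊆ K_j` of a `ℤ_p`-extension with Fukuda index `0` over a field with one
prime above `p`**: there is `σ ∈ Gal(K_j/K_k)` acting as `γ^{p^k}` on `K_j ⊆ K̄`, generating `Gal(K_j/K_k)`, with `N_{K_j/K_k} c = 1 ⟺ c = σ d / d` for every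
class `c` of `K_j`, and the `p`-primary refinement (`c` `p`-primary ⟹ `d` may be taken `p`-primary).
[cite: Washington1997, §13.3 Lemma 13.15 and Prop. 13.22] [cite: Lang1990, Ch. 5 §4 Thm. 4.1 and Corollary] -/
theorem exists_topGenerator_pow_aut_forall_classGroupNorm_eq_one_iff (hκ : TotallyRamifiedFrom κ 0)
    (v₀ : HeightOneSpectrum (𝓞 K)) (hv₀ : ∀ w : HeightOneSpectrum (𝓞 K), ((p : ℕ) : 𝓞 K) ∈ w.asIdeal → w = v₀)
    {γ : absoluteGaloisGroup K} (hγ : κ.IsTopGenerator γ) (hkj : k ≤ j) [NumberField (κ.layer k)] [NumberField (κ.layer j)] :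
    ∃ σ : (κ.layer j) ≃ₐ[κ.layer k] (κ.layer j),
      (∀ x : κ.layer j, ((σ x : κ.layer j) : AlgebraicClosure K) = (γ ^ p ^ k) • (x : AlgebraicClosure K)) ∧ Subgroup.zpowers σ = ⊤ ∧
      (∀ c : ClassGroup (𝓞 (κ.layer j)), classGroupNorm (κ.layer k) (κ.layer j) c = 1 ↔
        ∃ d : ClassGroup (𝓞 (κ.layer j)), c = ClassGroup.mulEquiv (AmbiguousClass.intAut σ) d / d) ∧
      (∀ {m : ℕ} {c : ClassGroup (𝓞 (κ.layer j))}, c ^ p ^ m = 1 → classGroupNorm (κ.layer k) (κ.layer j) c = 1 →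
        ∃ d : ClassGroup (𝓞 (κ.layer j)), d ^ p ^ (Fintype.card (ClassGroup (𝓞 (κ.layer j)))).factorization p = 1 ∧
          c = ClassGroup.mulEquiv (AmbiguousClass.intAut σ) d / d) := by
  obtain ⟨σ, hσx, hσ⟩ := exists_aut_layer_layer_eq_topGenerator_pow κ hγ hkj
  exact ⟨σ, hσx, hσ, fun c => classGroupNorm_layer_layer_eq_one_iff_of_zpowers_eq_top κ hκ v₀ hv₀ σ hσ c,
    fun hc hN => forall_primary_eq_div_of_zpowers_eq_top κ hκ v₀ hv₀ σ hσ hc hN⟩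

end Generator

/-! ## § Degrees: `[K_j : K_k] = p^{j−k}`, `K_j/K_k` Galois, `#Gal(K_j/K_k) = p^{j−k}` (generic compatible algebra structure) -/

section Degrees

variable {k j : ℕ} [Algebra (κ.layer k) (κ.layer j)] [IsScalarTower K (κ.layer k) (κ.layer j)]

/-- **`[K_j : K_k] = p^{j−k}`** for `k ≤ j` (tower law with `[K_n : K] = pⁿ`). [cite: Washington1997, §13.1 (`[K_n : K] = pⁿ`)] -/
theorem finrank_layer_layer (hkj : k ≤ j) : Module.finrank (κ.layer k) (κ.layer j) = p ^ (j - k) := by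
  haveI : FiniteDimensional K (κ.layer k) := κ.finiteDimensional_layer_holds k
  haveI : FiniteDimensional K (κ.layer j) := κ.finiteDimensional_layer_holds j
  have hp0 : 0 < p := hp.out.pos
  have h := Module.finrank_mul_finrank K (κ.layer k) (κ.layer j)
  rw [κ.finrank_layer_holds k, κ.finrank_layer_holds j] at h
  rw [← Nat.pow_div hkj hp0]
  exact (Nat.div_eq_of_eq_mul_right (pow_pos hp0 k) h.symm).symm

/-- **`K_j/K_k` is Galois** (top of the Galois tower `K ⊆ K_k ⊆ K_j`). [cite: Washington1997, §13.1] -/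
theorem isGalois_layer_layer : IsGalois (κ.layer k) (κ.layer j) := by
  haveI : IsGalois K (κ.layer j) := κ.isGalois_layer_holds j
  exact IsGalois.tower_top_of_isGalois K (κ.layer k) (κ.layer j)

/-- **`#Gal(K_j/K_k) = p^{j−k}`** for `k ≤ j`. [cite: Washington1997, §13.1 (`Gal(K_m/K_n) ≅ ℤ/p^{m−n}`)] -/
theorem card_aut_layer_layer (hkj : k ≤ j) : Nat.card ((κ.layer j) ≃ₐ[κ.layer k] (κ.layer j)) = p ^ (j - k) := by
  haveI : FiniteDimensional K (κ.layer j) := κ.finiteDimensional_layer_holds j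
  haveI : FiniteDimensional (κ.layer k) (κ.layer j) := Module.Finite.of_restrictScalars_finite K _ _
  haveI : IsGalois (κ.layer k) (κ.layer j) := isGalois_layer_layer κ
  rw [IsGalois.card_aut_eq_finrank, finrank_layer_layer κ hkj]

/-- **A generator of `Gal(K_j/K_k)` has order `p^{j−k}`** (`k ≤ j`). [cite: Washington1997, §13.1 (`Gal(K_m/K_n) ≅ ℤ/p^{m−n}`)] -/
theorem orderOf_eq_of_zpowers_eq_top_layer_layer (hkj : k ≤ j) {σ : (κ.layer j) ≃ₐ[κ.layer k] (κ.layer j)} (hσ : Subgroup.zpowers σ = ⊤) :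
    orderOf σ = p ^ (j - k) := by
  rw [orderOf_eq_card_of_zpowers_eq_top hσ, card_aut_layer_layer κ hkj]

end Degrees

end Literature.NumberTheory.IwasawaTheory

end
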